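import Mathlib
import HarnessLib
/-!
# HodgeLocusCensusAokiShiodaRows — the Aoki–Shioda complete-intersection presentations of the census (cell pub-hlocus, referee gen 14, REFEREE.md R28)
HONEST FRAMING: certified instances and evidence bearing on the general Hodge conjecture; no claim.

Engine B (ivhs-2, 2026-08-19T21:15Z) and engine R (referee g14, `ref_as_single.py`, two routes, two primes) agree on the IVHS ranks of the
single Aoki–Shioda CI classes at the Fermat point: (n,d) = (2,4): 1, (2,6): 9, (4,4): 11, (4,6): 62, (6,4) CI(2,2,1,1): 36, (6,4) CI(2,2,2,2): 70,
(8,4) CI(2,2,1,1,1): 83, (8,4) CI(2,2,2,2,1): 154 — each equal to the codimension of ⟨f_i, g_i⟩_d in S_d, as Villaflor arXiv:2001.01019 Ex. 2.1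
(Dan 2014) predicts for a complete-intersection class (V_[Z] smooth, reduced, T V_[Z] = ⟨f,g⟩_d). What is kernel-checked here is the INPUT of that
theorem: the block identities Σ f_i g_i = Fermat block used by both engines (type 2e with e = 2, d = 4, over any commutative ring with κ² = 2, i² = −1;
type 3e with e = 2, d = 6, with κ² = −3 and ω² + ω + 1 = 0), the linear-pair cofactor identity for every degree d with ζ^d = −1, and the dimensions
dim S_d = C(n+1+d, d) of the ambient spaces. The ranks themselves are the cited two-implementation evidence (COMPONENTS.md (B) table; data
`data/ivhs/AS/B-AS_<n>_<d>.json`, `data/ivhs/census/refg14/refg14-AS-single-and-mixed.json`), not Lean theorems.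
-/
namespace Summit.HodgeConjecture.HodgeConjecture.HodgeLocus.Census.AokiShioda

variable {R : Type*} [CommRing R]

/-- Aoki–Shioda block of type 2e, e = 2 (d = 4): with κ² = 2 and i² = −1,
f₁g₁ + f₂g₂ = a⁴ + b⁴ + c⁴ + w⁴ for f₁ = c² − κab, g₁ = c² + κab, f₂ = a² + b² + i w², g₂ = a² + b² − i w²
(engine B `asengine.block`, engine R `ref_as_single.Fermat.block`, both assert this identity at runtime). -/
theorem block_d4 (κ i a b c w : R) (hκ : κ ^ 2 = 2) (hi : i ^ 2 = -1) :
    (c ^ 2 - κ * a * b) * (c ^ 2 + κ * a * b) + (a ^ 2 + b ^ 2 + i * w ^ 2) * (a ^ 2 + b ^ 2 - i * w ^ 2)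
      = a ^ 4 + b ^ 4 + c ^ 4 + w ^ 4 := by
  linear_combination (-(a ^ 2 * b ^ 2)) * hκ - w ^ 4 * hi

/-- Aoki–Shioda block of type 3e, e = 2 (d = 6): with κ² = −3 and ω² + ω + 1 = 0,
f₁g₁ + f₂g₂ = a⁶ + b⁶ + c⁶ + w⁶ for f₁ = w³ − κabc, g₁ = w³ + κabc, f₂ = a² + b² + c²,
g₂ = (a² + ωb² + ω²c²)(a² + ω²b² + ωc²). -/
theorem block_d6 (κ ω a b c w : R) (hκ : κ ^ 2 = -3) (hω : ω ^ 2 + ω + 1 = 0) :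
    (w ^ 3 - κ * a * b * c) * (w ^ 3 + κ * a * b * c)
      + (a ^ 2 + b ^ 2 + c ^ 2) * ((a ^ 2 + ω * b ^ 2 + ω ^ 2 * c ^ 2) * (a ^ 2 + ω ^ 2 * b ^ 2 + ω * c ^ 2))
      = a ^ 6 + b ^ 6 + c ^ 6 + w ^ 6 := by
  linear_combination (-(a ^ 2 * b ^ 2 * c ^ 2)) * hκ
    + (a ^ 2 + b ^ 2 + c ^ 2) * (b ^ 2 * c ^ 2 * ω ^ 2 + (b ^ 4 + c ^ 4 - b ^ 2 * c ^ 2) * ω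
        + (a ^ 2 * b ^ 2 + a ^ 2 * c ^ 2 - b ^ 4 - c ^ 4 + b ^ 2 * c ^ 2)) * hω

/-- the linear-pair factor x_u − ζ x_v with its cofactor Σ_l ζ^l x_u^{d−1−l} x_v^l (engine B `asengine.pair`, engine R `Fermat.pair`):
(x_u − ζ x_v) · Σ_{l<d} x_u^{d−1−l} (ζ x_v)^l = x_u^d + x_v^d whenever ζ^d = −1. -/
theorem pair_cofactor (ζ u v : R) (d : ℕ) (hζ : ζ ^ d = -1) :
    (u - ζ * v) * (∑ l ∈ Finset.range d, u ^ (d - 1 - l) * (ζ * v) ^ l) = u ^ d + v ^ d := by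
  have h := geom_sum₂_mul u (ζ * v) d
  rw [Finset.sum_congr rfl (fun l _ => mul_comm (u ^ l) ((ζ * v) ^ (d - 1 - l))),
    mul_pow, hζ] at h
  -- h : (∑ l, (ζv)^(d-1-l) * u^l) * (u - ζv) = u^d - (-1) * v^d ; reindex the sum
  rw [mul_comm]
  have hrev : (∑ l ∈ Finset.range d, u ^ (d - 1 - l) * (ζ * v) ^ l)
      = ∑ l ∈ Finset.range d, (ζ * v) ^ (d - 1 - l) * u ^ l := by
    rw [← Finset.sum_range_reflect]
    refine Finset.sum_congr rfl (fun l hl => ?_)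
    have hl' := Finset.mem_range.mp hl
    rw [Nat.sub_sub_self (by omega)]; ring
  rw [hrev, h]; ring

/-- dim S_d = C(n+1+d, d) for the eight single Aoki–Shioda cells: (2,4) 35, (2,6) 84, (4,4) 126, (4,6) 462, (6,4) 330, (8,4) 715
(engine B `dim_S_d`, engine R `dim_S_d`). -/
theorem dimS_cells :
    Nat.choose 7 4 = 35 ∧ Nat.choose 9 6 = 84 ∧ Nat.choose 9 4 = 126 ∧ Nat.choose 11 6 = 462
      ∧ Nat.choose 11 4 = 330 ∧ Nat.choose 13 4 = 715 := by decide

/-- the certified single-class ranks (two engines, two routes each) as a table; the bookkeeping identity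
rank + dim ⟨f,g⟩_d = dim S_d is what both engines' route (I) computes. -/
def singleRankTable : List (ℕ × ℕ × List ℕ × ℕ) :=
  [(2, 4, [2, 2], 1), (2, 6, [3, 2], 9), (4, 4, [2, 2, 1], 11), (4, 6, [3, 2, 1], 62),
   (6, 4, [2, 2, 1, 1], 36), (6, 4, [2, 2, 2, 2], 70), (8, 4, [2, 2, 1, 1, 1], 83), (8, 4, [2, 2, 2, 2, 1], 154)]

/-- every table row has a CI type of length n/2 + 1 with Σ(d_i) ≤ ... : the number of generators is n/2 + 1 (CI of codimension n/2 + 1 in ℙ^{n+1}). -/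
theorem singleRankTable_ci_length :
    ∀ r ∈ singleRankTable, r.2.2.1.length = r.1 / 2 + 1 := by decide

/-- each rank is below the ambient dimension C(n+1+d, d) (sanity bookkeeping). -/
theorem singleRankTable_rank_lt_dimS :
    ∀ r ∈ singleRankTable, r.2.2.2 < Nat.choose (r.1 + 1 + r.2.1) r.2.1 := by decide

end Summit.HodgeConjecture.HodgeConjecture.HodgeLocus.Census.AokiShioda
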